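import Summits.Ventures.PackingBounds.ThreePointCert.K7d12Agg1
import Summits.Ventures.PackingBounds.ThreePointCert.CheckFastFZ

/-!
# κ(7) ≤ 134: kernel validation of the blocks of (i') and of the `FI` expansion (Gram form, `ThreePointCert.CheckFastF`, trie-free check `CheckFastFZ`)

Framing: lottery ticket; floor = certified bounds/negative ranges. Venture `PackingBounds` (cell
`pub-packcert`), three-point SDP family. Integer data of a feasible point of the Bachoc–Vallentin
semidefinite program (n = 7, s = 1/2, degree d = 12, symmetric
sums of squares), derived by `pub-packcert-lp/code/lean3pt/cert2lean_lp.py` from the exact rational certificate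
`sdp-d7-deg12-sym-lp-v1.json` of the cell (exact verifier #1 + verifier #2 of the other seat), in the units of the kernel
checker `ThreePointCert.Check` (soundness `ThreePointCert.Sound`/`Soundness`); Gram factors offset-encoded for the
Kronecker-packed chunk validation `ThreePointCert.CheckKron` (emitter `emitleanK.py`, lp gen 3). Generated file: plain
lists of integers / monomials. Part 3 of 3.
-/

namespace Summit.Ventures.PackingBounds.ThreePointCert.K7d12

open Literature.Geometry.DiscreteGeometry Literature.Geometry.DiscreteGeometry.PolyCert PolyCert.SPoly

set_option maxRecDepth 100000 in
set_option maxHeartbeats 0 in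
/-- `FI` expansion, blocks [8] (kernel, Gram form + sorted-merge zero test, `CheckFastF`/`CheckFastFZ`). -/
theorem okF_9 : FchunkOKZ K7d12.cert.n K7d12.cert.d [FBlk.mk 8 K7d12.fw8] K7d12.dFc8 K7d12.dFc9 = true := by
  decide +kernel

set_option maxRecDepth 100000 in
set_option maxHeartbeats 0 in
/-- `FI` expansion, blocks [9] (kernel, Gram form + sorted-merge zero test, `CheckFastF`/`CheckFastFZ`). -/
theorem okF_10 : FchunkOKZ K7d12.cert.n K7d12.cert.d [FBlk.mk 9 K7d12.fw9] K7d12.dFc9 K7d12.dFc10 = true := by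
  decide +kernel

set_option maxRecDepth 100000 in
set_option maxHeartbeats 0 in
/-- `FI` expansion, blocks [10, 11, 12] (kernel, Gram form + sorted-merge zero test, `CheckFastF`/`CheckFastFZ`). -/
theorem okF_11 : FchunkOKZ K7d12.cert.n K7d12.cert.d [FBlk.mk 10 K7d12.fw10, FBlk.mk 11 K7d12.fw11, FBlk.mk 12 K7d12.fw12] K7d12.dFc10 K7d12.eFP = true := by
  decide +kernel


end Summit.Ventures.PackingBounds.ThreePointCert.K7d12
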